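import Summits.FinalStateConjecture.FinalStateConjecture.Theorems.PhotonSphereChannelsTameHullDefs
import Literature.Geometry.Lorentzian.SpacetimeKretschmannScalar
import Literature.Geometry.Lorentzian.KerrCurvatureInvariants
import Literature.Geometry.Lorentzian.KerrDataProofs
import Literature.Geometry.Lorentzian.KerrSchildCoord
import HarnessLib

/-!
# Route PhotonSphereChannels · crux `ChannelsResolveTameDevelopmentsR` (K2R-T2, stmt-FinalStateConjecture-17430) —
# the Kretschmann scalar on an exact Kerr domain of outer communications

For the Kerr branch of the hull stubs (`TameHull.IsKerrDoc 𝓢 O M a`: an injective smooth chart of the Kerr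
exterior `{r > r₊}` onto `O` pulling `g` back EXACTLY to `g_{M,a}`) the one curvature quantity the tree reads
on `𝓢` (`Spacetime.kretschmannAt`) is determined on `O`: the chart is an isometric immersion of the Kerr
exterior spacetime, so at `Ψ x` the scalar is Kerr's closed form `48 M² Re (r + i a cos θ)⁶/Σ⁶` at `x`
(`kretschmannAt_comp_of_isIsometricImmersion`, `Kerr.kretschmannAt_spacetime`,
`Kerr.kretschmannScalar_closedForm_holds`). Consequences recorded for the workers of line
`dark-future-exactness` (parameter bookkeeping of Kerr elements by curvature, with
`…RHullKretschmannBase`'s base-point bounds):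

* `exists_kretschmannAt_eq_of_isKerrDoc` — every `y ∈ O` has `|Rm|²_𝓢(y) = |Rm|²_{g_{M,a}}(x)` for some
  exterior point `x`;
* `kretschmannAt_schwarzschildDoc` — for `a = 0`: `|Rm|²_𝓢(y) = 48M²/r(x)⁶` with `r(x) > 2M`, hence
  `0 < |Rm|²_𝓢(y) < ¾ M⁻⁴` on all of `O` (`kretschmannAt_pos_lt_of_isKerrDoc_schwarzschild`): a
  Schwarzschild element whose doc carries a point with `|Rm|² ≥ κ` has `M⁴ < ¾ κ⁻¹` — an a-priori MASS BOUND
  from curvature (`mass_pow_four_lt_of_isKerrDoc_schwarzschild`).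

All results proved (`[Kerr.Facts]` discharged inline); no definitions.

## References

* M. Visser, arXiv:0706.0622, §3 (Kretschmann scalar of Kerr). [arXiv07060622]
* B. O'Neill, *Semi-Riemannian geometry* (1983), Ch. 3, Prop. 3.59. [ONeill1983]
-/

noncomputable section

set_option maxSynthPendingDepth 3
set_option linter.dupNamespace false

open Set Filter Function TopologicalSpace Metric
open scoped Topology Manifold ContDiff ENNReal NNReal

namespace Summit.FinalStateConjecture.FinalStateConjecture.Theorems.HullCurvature

open Literature.Geometry.Lorentzian
open Summit.FinalStateConjecture.FinalStateConjecture.Theorems.TameHull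

/-- **The Kretschmann scalar on an exact Kerr d.o.c. is Kerr's**: if `IsKerrDoc 𝓢 O M a` with `0 ≤ M`,
every `y ∈ O` is `Ψ x` for an exterior point `x`, and `|Rm|²_𝓢(y) = |Rm|²_{g_{M,a}}(x)` (the chart is an
isometric immersion of `Kerr.spacetime M a r₊`; transport + chart value). [cite: arXiv07060622, §3] -/
theorem exists_kretschmannAt_eq_of_isKerrDoc {𝓢 : Spacetime.{0} 4} {O : Set 𝓢.carrier} {M a : ℝ}
    (h : IsKerrDoc 𝓢 O M a) (hM : 0 ≤ M) {y : 𝓢.carrier} (hy : y ∈ O) :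
    ∃ x : E4, x ∈ (Kerr.exterior M a : Set E4) ∧
      𝓢.kretschmannAt y = MetricCoord.rmNormSqAt (Kerr.bilin M a) x := by
  obtain ⟨Ψ, -, hsmooth, hrange, hdev, -⟩ := h
  haveI : Kerr.Facts :=
    ⟨Kerr.isConnected_region_holds, Kerr.contMDiff_bilin_holds, Kerr.contMDiff_timeVector_holds⟩
  rw [← hrange] at hy
  obtain ⟨x, rfl⟩ := hy
  have hE : (Kerr.spacetime M a (Kerr.rPlus M a) hM).metric.IsIsometricImmersion
      𝓢.metric.toPseudoRiemannianMetric Ψ := by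
    refine ⟨hsmooth, fun z ↦ ?_⟩
    have h := hdev z
    rw [Spacetime.deviation, sub_eq_zero] at h
    exact h
  refine ⟨x.1, x.2, ?_⟩
  rw [Spacetime.kretschmannAt_comp_of_isIsometricImmersion (𝓢 := 𝓢)
    (𝓤 := Kerr.spacetime M a (Kerr.rPlus M a) hM) hE x]
  exact (Kerr.kretschmannAt_spacetime Kerr.kretschmannScalar_closedForm_holds M a (Kerr.rPlus M a) hM
    x).trans (Kerr.kretschmannScalar_closedForm_holds M a x.1 (Kerr.radius_pos_of_mem_region x.2)).symm

/-- **Schwarzschild closed form**: `|Rm|²_{g_{M,0}}(x) = 48 M²/r⁶` for `r > 0`. [cite: arXiv07060622, §3] -/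
theorem rmNormSqAt_schwarzschild (M : ℝ) {x : E4} (hr : 0 < Kerr.radius 0 x) :
    MetricCoord.rmNormSqAt (Kerr.bilin M 0) x = 48 * M ^ 2 / Kerr.radius 0 x ^ 6 := by
  rw [Kerr.kretschmannScalar_closedForm_holds M 0 x hr]
  simp only [zero_mul, Complex.ofReal_zero, add_zero]
  rw [← Complex.ofReal_pow, Complex.ofReal_re]
  have h6 : (Kerr.radius 0 x ^ 2 + (0 : ℝ) ^ 2) ^ 6 = Kerr.radius 0 x ^ 12 := by ring
  rw [h6]
  have hr0 : Kerr.radius 0 x ≠ 0 := hr.ne'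
  field_simp

/-- **On an exact Schwarzschild d.o.c. the Kretschmann scalar is `48M²/r⁶` with `r > 2M`**: every
`y ∈ O` has `|Rm|²_𝓢(y) = 48 M²/r⁶` for some `r > 2M`. [cite: arXiv07060622, §3] -/
theorem kretschmannAt_schwarzschildDoc {𝓢 : Spacetime.{0} 4} {O : Set 𝓢.carrier} {M : ℝ}
    (h : IsKerrDoc 𝓢 O M 0) (hM : 0 ≤ M) {y : 𝓢.carrier} (hy : y ∈ O) :
    ∃ r : ℝ, 2 * M < r ∧ 𝓢.kretschmannAt y = 48 * M ^ 2 / r ^ 6 := by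
  obtain ⟨x, hx, hK⟩ := exists_kretschmannAt_eq_of_isKerrDoc h hM hy
  have hx' : max (Kerr.rPlus M 0) 0 < Kerr.radius 0 x := by
    rw [Kerr.exterior, SetLike.mem_coe, Kerr.mem_region] at hx; exact hx
  have hr2M : 2 * M < Kerr.radius 0 x := by
    rw [Kerr.rPlus_zero_right hM] at hx'
    exact (le_max_left _ _).trans_lt hx'
  have hr : 0 < Kerr.radius 0 x := (le_max_right _ _).trans_lt hx'
  exact ⟨Kerr.radius 0 x, hr2M, hK.trans (rmNormSqAt_schwarzschild M hr)⟩

/-- **Curvature window of a Schwarzschild d.o.c.**: `0 < |Rm|²_𝓢(y) < ¾ M⁻⁴` on `O` (`48M²/r⁶` with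
`r > 2M > 0`). [cite: arXiv07060622, §3] -/
theorem kretschmannAt_pos_lt_of_isKerrDoc_schwarzschild {𝓢 : Spacetime.{0} 4} {O : Set 𝓢.carrier} {M : ℝ}
    (h : IsKerrDoc 𝓢 O M 0) (hM : 0 < M) {y : 𝓢.carrier} (hy : y ∈ O) :
    0 < 𝓢.kretschmannAt y ∧ 𝓢.kretschmannAt y < 3 / (4 * M ^ 4) := by
  obtain ⟨r, hr, hK⟩ := kretschmannAt_schwarzschildDoc h hM.le hy
  have hr0 : 0 < r := by linarith
  rw [hK]
  refine ⟨by positivity, ?_⟩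
  rw [div_lt_div_iff₀ (by positivity) (by positivity)]
  -- `48 M² · 4 M⁴ < 3 r⁶` since `r > 2M > 0`
  have h2 : (2 * M) ^ 6 < r ^ 6 := pow_lt_pow_left₀ hr (by positivity) (by norm_num)
  nlinarith [h2]

/-- **A-priori mass bound from curvature** (Schwarzschild elements): if an exact Schwarzschild d.o.c.
`O` of mass `M > 0` carries a point with `|Rm|²_𝓢(y) ≥ κ > 0`, then `M⁴ < ¾ κ⁻¹`. With
`…RHullKretschmannBase` (base points of hull elements inherit `|Rm|² ≥ κ` from the development) this bounds
the masses of Schwarzschild elements of a based hull from the development's curvature.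
[cite: arXiv07060622, §3] -/
theorem mass_pow_four_lt_of_isKerrDoc_schwarzschild {𝓢 : Spacetime.{0} 4} {O : Set 𝓢.carrier} {M : ℝ}
    (h : IsKerrDoc 𝓢 O M 0) (hM : 0 < M) {y : 𝓢.carrier} (hy : y ∈ O) {κ : ℝ} (hκ : 0 < κ)
    (hyκ : κ ≤ 𝓢.kretschmannAt y) : M ^ 4 < 3 / (4 * κ) := by
  obtain ⟨-, hlt⟩ := kretschmannAt_pos_lt_of_isKerrDoc_schwarzschild h hM hy
  have h1 : κ < 3 / (4 * M ^ 4) := hyκ.trans_lt hlt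
  rw [lt_div_iff₀ (by positivity)] at h1
  rw [lt_div_iff₀ (by positivity)]
  nlinarith

/-- **Summary (registered sub-goal).** On an exact Kerr d.o.c. the Kretschmann scalar of the host is Kerr's
closed form at the chart preimage; for Schwarzschild d.o.c.s it lies in `(0, ¾M⁻⁴)`, so a point of `O` with
`|Rm|² ≥ κ > 0` forces `M⁴ < ¾κ⁻¹`. [cite: arXiv07060622, §3] -/
theorem kerrDoc_curvature_summary : (∀ {𝓢 : Spacetime.{0} 4} {O : Set 𝓢.carrier} {M a : ℝ}, IsKerrDoc 𝓢 O M a → 0 ≤ M → ∀ y ∈ O, ∃ x : E4, x ∈ (Kerr.exterior M a : Set E4) ∧ 𝓢.kretschmannAt y = MetricCoord.rmNormSqAt (Kerr.bilin M a) x) ∧ (∀ {𝓢 : Spacetime.{0} 4} {O : Set 𝓢.carrier} {M : ℝ}, IsKerrDoc 𝓢 O M 0 → 0 < M → ∀ y ∈ O, 0 < 𝓢.kretschmannAt y ∧ 𝓢.kretschmannAt y < 3 / (4 * M ^ 4)) ∧ ∀ {𝓢 : Spacetime.{0} 4} {O : Set 𝓢.carrier} {M : ℝ}, IsKerrDoc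 𝓢 O M 0 → 0 < M → ∀ y ∈ O, ∀ κ : ℝ, 0 < κ → κ ≤ 𝓢.kretschmannAt y → M ^ 4 < 3 / (4 * κ) :=
  ⟨fun h hM _ hy ↦ exists_kretschmannAt_eq_of_isKerrDoc h hM hy,
    fun h hM _ hy ↦ kretschmannAt_pos_lt_of_isKerrDoc_schwarzschild h hM hy,
    fun h hM _ hy _ hκ hyκ ↦ mass_pow_four_lt_of_isKerrDoc_schwarzschild h hM hy hκ hyκ⟩

end Summit.FinalStateConjecture.FinalStateConjecture.Theorems.HullCurvature

end
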